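import Literature.AlgebraicGeometry.Resolution.MuPTorsorLocalUniformizationAllFields
import Literature.AlgebraicGeometry.Resolution.LocalUniformizationAbhyankarPlacesProofs
import HarnessLib

/-!
# The `μ_p`-torsor problem lives at non-Abhyankar valuations (arbitrary ground field)

**Sources.** M. Temkin, *Inseparable local uniformization*, J. Algebra **373** (2013) 65–119,
arXiv:0804.1554, Thm. 1.3.2 and Rem. 1.3.5 (ii) (named fact `Temkin2013Relative`; the
finiteness-free reduction `isLocallyUniformizable_of_muPTorsorStepsAt_of_relative`);
S. D. Cutkosky, *Local uniformization of Abhyankar valuations*, Michigan Math. J. **71**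
(2022), Thm. 1.3 (PROVED in the tree: `Cutkosky2022_Thm13_holds` — Abhyankar places of a
finitely generated `K/k` over an arbitrary ground field admit a regular affine model).

**What is recorded (combination of the two, no new named fact).** Given `Temkin2013Relative`,
local uniformization in characteristic `p` is equivalent to climbing `μ_p`-torsor steps at the
NON-Abhyankar valuations only (`localUniformizationInChar_iff_muPTorsorStepsAt_nonAbhyankar`),
over every ground field of characteristic `p`; pointwise, a valuation ring `O ⊇ k` of a finitely
generated `K/k` is uniformizable as soon as it is an Abhyankar place or its torsor steps climb
(`isLocallyUniformizable_of_abhyankar_or_muPTorsorStepsAt`). This is the arbitrary-ground-field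
form of `localUniformizationPerfectInChar_iff_posDefect` (perfect `k`, transcendence defect).
-/

noncomputable section

namespace Literature.AlgebraicGeometry.Resolution

universe u

/-- **Abhyankar places are uniformizable over any ground field** (Cutkosky 2022, Thm. 1.3, in
the vocabulary of `IsLocallyUniformizable`). [cite: Cutkosky2022, Thm. 1.3] -/
theorem isLocallyUniformizable_of_isAbhyankarPlace {k K : Type u} [Field k] [Field K]
    [Algebra k K] (hfg : (⊤ : IntermediateField k K).FG) (O : ValuationSubring K)
    (hk : ∀ c : k, algebraMap k K c ∈ O)
    (hA : IsAbhyankarPlace O (algebraMap k K).fieldRange ⊤) : IsLocallyUniformizable k K O := by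
  have hbot : (⊥ : Subalgebra k K).toSubring ≤ O.toSubring := by
    intro x hx
    obtain ⟨c, rfl⟩ := Algebra.mem_bot.mp (show x ∈ (⊥ : Subalgebra k K) from hx)
    exact hk c
  obtain ⟨A, h, -, hAfg, hAfr, hreg⟩ :=
    Cutkosky2022_Thm13_holds k K hfg O hk hA ⊥ Subalgebra.fg_bot hbot
  exact ⟨A, h, hAfg, hAfr, hreg⟩

/-- **Pointwise dichotomy over an arbitrary ground field.** Given Temkin's relative theorem, a
valuation ring `O ⊇ k` of a finitely generated `K/k` (`char k = p`) is locally uniformizable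
over `k` if it is an Abhyankar place (Cutkosky) or if local uniformizability climbs its
`μ_p`-torsor steps (`isLocallyUniformizable_of_muPTorsorStepsAt_of_relative`).
[cite: Temkin2013, Rem. 1.3.5 (ii); Cutkosky2022, Thm. 1.3] -/
theorem isLocallyUniformizable_of_abhyankar_or_muPTorsorStepsAt {p : ℕ} [Fact p.Prime]
    (hT : Temkin2013Relative.{u}) {k K : Type u} [Field k] [CharP k p] [Field K] [Algebra k K]
    (hfg : (⊤ : IntermediateField k K).FG) (O : ValuationSubring K)
    (hk : ∀ c : k, algebraMap k K c ∈ O)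
    (H : ¬ IsAbhyankarPlace O (algebraMap k K).fieldRange ⊤ → MuPTorsorStepsAt p k O) :
    IsLocallyUniformizable k K O := by
  by_cases hA : IsAbhyankarPlace O (algebraMap k K).fieldRange ⊤
  · exact isLocallyUniformizable_of_isAbhyankarPlace hfg O hk hA
  · exact isLocallyUniformizable_of_muPTorsorStepsAt_of_relative hT hfg O hk (H hA)

/-- **Local uniformization in characteristic `p` ⟺ `μ_p`-torsor steps at the non-Abhyankar
valuations**, over every ground field of characteristic `p`, given Temkin's relative theorem.
[cite: Temkin2013, Rem. 1.3.5 (ii); Cutkosky2022, Thm. 1.3] -/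
theorem localUniformizationInChar_iff_muPTorsorStepsAt_nonAbhyankar {p : ℕ} [Fact p.Prime]
    (hT : Temkin2013Relative.{u}) :
    LocalUniformizationInChar.{u} p ↔
      ∀ (k K : Type u) [Field k] [CharP k p] [Field K] [Algebra k K],
        (⊤ : IntermediateField k K).FG →
        ∀ O : ValuationSubring K, (∀ c : k, algebraMap k K c ∈ O) →
          ¬ IsAbhyankarPlace O (algebraMap k K).fieldRange ⊤ → MuPTorsorStepsAt p k O :=
  ⟨fun h k K _ _ _ _ _ O _ _ => h.muPTorsorInChar k K O,
    fun h k K _ _ _ _ hfg O hk =>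
      isLocallyUniformizable_of_abhyankar_or_muPTorsorStepsAt hT hfg O hk (h k K hfg O hk)⟩

end Literature.AlgebraicGeometry.Resolution

end
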